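import Summits.Ventures.WeilGRH.CharacterFamilyProgressions
import HarnessLib

/-!
# GRH arm (rh-explicit, venture WeilGRH): arbitrary non-negative weights, and the EVEN-character family —
  the maximal real subfield and Odlyzko's totally real constant `8πe^{γ+π/2}`

Cell `rh-explicit`, WEIL TRACK (structure seat weil-3, gen8).  Sequel of `CharacterFamilyProgressions.lean`
(weights `w_χ = 1 + Re χ(u) ≥ 0`).  First the MASTER form (`weightedFamily_flatWindow_le`): for EVERY
weight `w ≥ 0` on the characters mod `q`, the `ζ` rung and the rungs of the weighted non-principal `χ` give
`2Σ_n Λ(n)n^{-1/2}(1 − log n/(2a))·ŵ(n) + Σ_χ w_χ(K_{κ(χ)} − I_{κ(χ)}(a)/a) ≤ (Σ_χ w_χ − w_1) log q + w_1·16 sinh²(a/2)/a`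
with `ŵ(n) = Σ_χ w_χ Re χ(n)` a function of `n mod q` — the cone of linear consequences of the rung family;
all the family theorems of this series are its specialisations.  For the unit `u = −1` the weight is `1 + χ(−1) = 2·𝟙[χ even]`
(`weight_neg_one_eq`): only the EVEN characters mod `q` — the characters of the maximal real subfield
`ℚ(ζ_q)⁺` — are used, and only the parity-`0` constant `K₀ ≥ 5.3716` appears
(`evenCharacterFamily_flatWindow_floor_le`, `q ≥ 3`): if `WeilPositivityOn a` and `WeilPositivityOnChar χ a`
for every non-principal EVEN `χ` mod `q`, then

  `φ(q)·(Σ_{n≡1 (q)} + Σ_{n≡−1 (q)}) Λ(n)n^{-1/2}(1 − log n/(2a)) + (φ(q)/2)(5.3716 − 5/a)`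
    `≤ (φ(q)/2 − 1) log q + 16 sinh²(a/2)/a`   (sums over `log n < 2a`).

`K₀ = log 8π + γ + π/2 = 5.37218…`, `e^{K₀} = 8πe^{γ+π/2} = 215.33…` is ODLYZKO's GRH lower bound for the
root discriminant of totally real number fields of large degree (the all-characters family of
`CharacterFamilyFlatTest.lean` carries `(K₀+K₁)/2 = log 8π + γ`, `8πe^γ = 44.76…`, the totally complex
constant): the even/odd archimedean constants of the GRH arm are Odlyzko's real-place / complex-place
constants, the arm's «uniform conductor floors» (necessary direction) are the conductor-aspect form of the
Odlyzko–Poitou–Serre discriminant bounds, and the prime powers `≡ ±1 (mod q)` — those splitting completely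
in `ℚ(ζ_q)⁺` — are the «local corrections» that raise the admissible conductor
(`log_level_ge_of_evenCharacterFamily`: the discriminant form).

No definitions, no named facts, RH/GRH-free; the odd characters are never used.

## References

* A. M. Odlyzko, *Bounds for discriminants and related estimates for class numbers, regulators and zeros
  of zeta functions: a survey of recent results*, Sém. Théor. Nombres Bordeaux 2 (1990) 119–141,
  (2.5)–(2.8). [Odlyzko1990Bounds]
* J.-P. Serre, *Minorations de discriminants* (note, October 1975), Œuvres III. [Serre1975Minorations]
* G. Poitou, *Sur les petits discriminants*, Sém. Delange–Pisot–Poitou 18 (1976/77) no. 6.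
  [Poitou1977Discriminants]
* A. Weil, *Sur les "formules explicites" de la théorie des nombres premiers* (1952), (11) pp. 261–262.
  [Weil1952FormulesExplicites]
-/

set_option autoImplicit false

noncomputable section

open Complex Filter Set MeasureTheory
open scoped Real Topology ComplexConjugate ArithmeticFunction.vonMangoldt

namespace Summit.Ventures.WeilGRH

open Literature.NumberTheory.LFunctions

variable {q : ℕ} {a : ℝ}

/-! ## The even characters alone: the maximal real subfield and Odlyzko's `8πe^{γ+π/2}` -/

/-! ## The master inequality: arbitrary non-negative weights on the character group -/

/-- **THE WEIGHTED FAMILY INEQUALITY FOR ARBITRARY NON-NEGATIVE WEIGHTS.**  Let `q ≠ 1`, `a > 0`, let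
`w ≥ 0` be any weight on the Dirichlet characters mod `q`, and assume the `ζ` rung `WeilPositivityOn a` and
`WeilPositivityOnChar χ a` for every non-principal `χ` carrying weight (`w_χ ≠ 0`).  Then

  `2 Σ_{log n<2a} Λ(n)n^{-1/2}(1 − log n/(2a))·ŵ(n) + Σ_χ w_χ (K_{κ(χ)} − I_{κ(χ)}(a)/a)`
    `≤ (Σ_χ w_χ − w_1)·log q + w_1·16 sinh²(a/2)/a`,   `ŵ(n) := Σ_χ w_χ Re χ(n)`.

`ŵ(n)` depends on `n mod q` only: EVERY non-negative weight gives a statement about the prime powers in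
residue classes below the horizon (the cone of linear consequences of the rung family).  The weights with
`ŵ` a non-negative combination of class indicators are the useful ones: `w ≡ 1` (`CharacterFamilyFlatTest`,
`ŵ = φ𝟙[n≡1]`), `w = 1 + Re χ(u)` (`CharacterFamilyProgressions`), `w = 𝟙_H` (`CharacterSubgroupFlatTest`,
`ŵ = |H|𝟙[n∈H^⊥]`), `w = 2·𝟙[χ even]` (below). -/
theorem weightedFamily_flatWindow_le [NeZero q] (hq : q ≠ 1) (ha : 0 < a) (hζ : WeilPositivityOn a)
    (w : DirichletCharacter ℂ q → ℝ) (hw : ∀ χ, 0 ≤ w χ)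
    (hχ : ∀ χ : DirichletCharacter ℂ q, χ ≠ 1 → w χ ≠ 0 → WeilPositivityOnChar χ a) :
    2 * (∑ n ∈ weilPrimeIndex a, (Λ n : ℝ) / Real.sqrt n * (1 - Real.log n / (2 * a)) *
          ∑ χ : DirichletCharacter ℂ q, w χ * (χ (n : ZMod q)).re) +
        ∑ χ : DirichletCharacter ℂ q, w χ *
          ((Real.log (4 * π) + Real.eulerMascheroniConstant +
              2 * ∫ t in Ioi (0 : ℝ), weilKillingDensityPar (charParity χ) t) -
            1 / a * ∫ t in Ioi (0 : ℝ), weilArchDensityPar (charParity χ) t * min t (2 * a)) ≤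
      ((∑ χ : DirichletCharacter ℂ q, w χ) - w 1) * Real.log q + w 1 * (16 * Real.sinh (a / 2) ^ 2 / a) := by
  classical
  set c : ℕ → ℝ := fun n ↦ (Λ n : ℝ) / Real.sqrt n * (1 - Real.log n / (2 * a)) with hc
  set K : DirichletCharacter ℂ q → ℝ := fun χ ↦
    (Real.log (4 * π) + Real.eulerMascheroniConstant +
        2 * ∫ t in Ioi (0 : ℝ), weilKillingDensityPar (charParity χ) t) -
      1 / a * ∫ t in Ioi (0 : ℝ), weilArchDensityPar (charParity χ) t * min t (2 * a) with hK
  set B : DirichletCharacter ℂ q → ℝ := fun χ ↦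
    if χ = 1 then 16 * Real.sinh (a / 2) ^ 2 / a else Real.log q with hB
  -- weighted slots (a zero weight needs no rung)
  have hslot : ∀ χ : DirichletCharacter ℂ q,
      w χ * (2 * (∑ n ∈ weilPrimeIndex a, c n * (χ (n : ZMod q)).re) + K χ) ≤ w χ * B χ := by
    intro χ
    by_cases h0 : w χ = 0
    · rw [h0, zero_mul, zero_mul]
    have h : 2 * (∑ n ∈ weilPrimeIndex a, (Λ n : ℝ) / Real.sqrt n *
          ((1 - Real.log n / (2 * a)) * (χ (n : ZMod q)).re)) + K χ ≤ B χ := by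
      by_cases h1 : χ = 1
      · subst h1
        simpa only [hK, hB, if_true, add_sub_assoc'] using
          principal_flatWindow_le_of_weilPositivityOn (q := q) ha hζ
      · simpa only [hK, hB, if_neg h1, add_sub_assoc'] using
          flatWindow_le_log_of_weilPositivityOnChar hq χ ha (hχ χ h1 h0)
    have hs : ∑ n ∈ weilPrimeIndex a, c n * (χ (n : ZMod q)).re =
        ∑ n ∈ weilPrimeIndex a, (Λ n : ℝ) / Real.sqrt n *
          ((1 - Real.log n / (2 * a)) * (χ (n : ZMod q)).re) :=
      Finset.sum_congr rfl fun n _ ↦ by simp only [hc]; ring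
    refine mul_le_mul_of_nonneg_left ?_ (hw χ)
    rwa [hs]
  have hsumB : ∑ χ : DirichletCharacter ℂ q, w χ * B χ =
      ((∑ χ : DirichletCharacter ℂ q, w χ) - w 1) * Real.log q + w 1 * (16 * Real.sinh (a / 2) ^ 2 / a) := by
    have hB' : ∀ χ : DirichletCharacter ℂ q, w χ * B χ =
        w χ * Real.log q + if χ = 1 then w χ * (16 * Real.sinh (a / 2) ^ 2 / a - Real.log q) else 0 := by
      intro χ
      simp only [hB]
      split_ifs <;> ring
    simp_rw [hB']
    rw [Finset.sum_add_distrib, ← Finset.sum_mul, Finset.sum_ite_eq' Finset.univ (1 : DirichletCharacter ℂ q),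
      if_pos (Finset.mem_univ _)]
    ring
  have hsumP : ∑ χ : DirichletCharacter ℂ q, w χ * ∑ n ∈ weilPrimeIndex a, c n * (χ (n : ZMod q)).re =
      ∑ n ∈ weilPrimeIndex a, c n * ∑ χ : DirichletCharacter ℂ q, w χ * (χ (n : ZMod q)).re := by
    simp_rw [Finset.mul_sum]
    rw [Finset.sum_comm]
    exact Finset.sum_congr rfl fun n _ ↦ Finset.sum_congr rfl fun χ _ ↦ by ring
  have htot := Finset.sum_le_sum fun χ (_ : χ ∈ (Finset.univ : Finset (DirichletCharacter ℂ q))) ↦ hslot χ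
  simp_rw [mul_add] at htot
  rw [Finset.sum_add_distrib] at htot
  have h2 : ∑ χ : DirichletCharacter ℂ q, w χ * (2 * ∑ n ∈ weilPrimeIndex a, c n * (χ (n : ZMod q)).re) =
      2 * ∑ χ : DirichletCharacter ℂ q, w χ * ∑ n ∈ weilPrimeIndex a, c n * (χ (n : ZMod q)).re := by
    rw [Finset.mul_sum]
    exact Finset.sum_congr rfl fun χ _ ↦ by ring
  rw [h2, hsumP, hsumB] at htot
  simpa only [hc, hK] using htot

/-! ## The even characters -/

open scoped Classical in
/-- For `u = −1` the weight is `2·𝟙[χ even]`: `1 + Re χ(−1) = 2` if `χ` is even, `0` if odd. -/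
theorem weight_neg_one_eq [NeZero q] (χ : DirichletCharacter ℂ q) :
    1 + (χ (-1)).re = if χ.Even then 2 else 0 := by
  rcases χ.even_or_odd with h | h
  · rw [if_pos h, show χ (-1) = 1 from h]; norm_num
  · rw [if_neg h.not_even, show χ (-1) = -1 from h]; norm_num

/-- **THE EVEN-CHARACTER FAMILY** (`q ≥ 3`, `a > 0`): if `WeilPositivityOn a` and `WeilPositivityOnChar χ a`
for every non-principal EVEN character `χ` mod `q` (the characters of `ℚ(ζ_q)⁺`), then

  `φ(q)·Σ_{log n<2a, n≡±1 (q)} Λ(n)n^{-1/2}(1 − log n/(2a)) + (φ(q)/2)·(5.3716 − 5/a)`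
    `≤ (φ(q)/2 − 1)·log q + 16 sinh²(a/2)/a`

(the two classes `n ≡ 1` and `n ≡ −1` written as two sums).  Dropping the primes: the discriminant form
`(φ(q)/2 − 1) log q ≥ (φ(q)/2)(5.3716 − 5/a) − 16 sinh²(a/2)/a` with `5.3716 ≈ K₀ = log(8πe^{γ+π/2})`,
`8πe^{γ+π/2} = 215.33…` = Odlyzko's GRH root-discriminant constant for totally real fields; the prime
powers `≡ ±1 (mod q)` (splitting completely in `ℚ(ζ_q)⁺`) are the terms that lower the admissible
conductor.  RH/GRH-free; the odd characters are not used. -/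
theorem evenCharacterFamily_flatWindow_floor_le [NeZero q] (hq : 2 < q) (ha : 0 < a)
    (hζ : WeilPositivityOn a)
    (hχ : ∀ χ : DirichletCharacter ℂ q, χ ≠ 1 → χ.Even → WeilPositivityOnChar χ a) :
    (q.totient : ℝ) * (∑ n ∈ (weilPrimeIndex a).filter (fun n : ℕ ↦ (n : ZMod q) = 1),
          (Λ n : ℝ) / Real.sqrt n * (1 - Real.log n / (2 * a))) +
        (q.totient : ℝ) * (∑ n ∈ (weilPrimeIndex a).filter (fun n : ℕ ↦ (n : ZMod q) = -1),
          (Λ n : ℝ) / Real.sqrt n * (1 - Real.log n / (2 * a))) +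
        (q.totient : ℝ) / 2 * (5.3716 - 5 / a) ≤
      ((q.totient : ℝ) / 2 - 1) * Real.log q + 16 * Real.sinh (a / 2) ^ 2 / a := by
  classical
  haveI : Fact (2 < q) := ⟨hq⟩
  have hq1 : q ≠ 1 := by omega
  set c : ℕ → ℝ := fun n ↦ (Λ n : ℝ) / Real.sqrt n * (1 - Real.log n / (2 * a)) with hc
  set K : DirichletCharacter ℂ q → ℝ := fun χ ↦
    (Real.log (4 * π) + Real.eulerMascheroniConstant +
        2 * ∫ t in Ioi (0 : ℝ), weilKillingDensityPar (charParity χ) t) -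
      1 / a * ∫ t in Ioi (0 : ℝ), weilArchDensityPar (charParity χ) t * min t (2 * a) with hK
  set B : DirichletCharacter ℂ q → ℝ := fun χ ↦
    if χ = 1 then 16 * Real.sinh (a / 2) ^ 2 / a else Real.log q with hB
  set w : DirichletCharacter ℂ q → ℝ := fun χ ↦ 1 + (χ (-1 : ZMod q)).re with hw
  have hu1 : ((-1 : (ZMod q)ˣ) : ZMod q) ≠ 1 := by
    rw [Units.val_neg, Units.val_one]; exact ZMod.neg_one_ne_one
  -- weighted slots: the weight vanishes on odd characters, so only even rungs are needed
  have hslot : ∀ χ : DirichletCharacter ℂ q,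
      w χ * (2 * (∑ n ∈ weilPrimeIndex a, c n * (χ (n : ZMod q)).re) + K χ) ≤ w χ * B χ := by
    intro χ
    by_cases hev : χ.Even
    · have h : 2 * (∑ n ∈ weilPrimeIndex a, (Λ n : ℝ) / Real.sqrt n *
            ((1 - Real.log n / (2 * a)) * (χ (n : ZMod q)).re)) + K χ ≤ B χ := by
        by_cases h1 : χ = 1
        · subst h1
          simpa only [hK, hB, if_true, add_sub_assoc'] using
            principal_flatWindow_le_of_weilPositivityOn (q := q) ha hζ
        · simpa only [hK, hB, if_neg h1, add_sub_assoc'] using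
            flatWindow_le_log_of_weilPositivityOnChar hq1 χ ha (hχ χ h1 hev)
      have hs : ∑ n ∈ weilPrimeIndex a, c n * (χ (n : ZMod q)).re =
          ∑ n ∈ weilPrimeIndex a, (Λ n : ℝ) / Real.sqrt n *
            ((1 - Real.log n / (2 * a)) * (χ (n : ZMod q)).re) :=
        Finset.sum_congr rfl fun n _ ↦ by simp only [hc]; ring
      refine mul_le_mul_of_nonneg_left ?_ (weight_nonneg χ _)
      rwa [hs]
    · have hw0 : w χ = 0 := by simp only [hw]; rw [weight_neg_one_eq, if_neg hev]
      rw [hw0, zero_mul, zero_mul]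
  -- right-hand sides
  have hsumw : ∑ χ : DirichletCharacter ℂ q, w χ = (q.totient : ℝ) := by
    simp only [hw]
    have := sum_weight_eq (q := q) (u := -1) hu1
    rwa [Units.val_neg, Units.val_one] at this
  have hsumB : ∑ χ : DirichletCharacter ℂ q, w χ * B χ =
      ((q.totient : ℝ) - 2) * Real.log q + 32 * Real.sinh (a / 2) ^ 2 / a := by
    have hB' : ∀ χ : DirichletCharacter ℂ q, w χ * B χ =
        w χ * Real.log q + if χ = 1 then w χ * (16 * Real.sinh (a / 2) ^ 2 / a - Real.log q) else 0 := by
      intro χ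
      simp only [hB]
      split_ifs <;> ring
    simp_rw [hB']
    rw [Finset.sum_add_distrib, ← Finset.sum_mul, Finset.sum_ite_eq' Finset.univ (1 : DirichletCharacter ℂ q),
      if_pos (Finset.mem_univ _), hsumw]
    have hw1 : w 1 = 2 := by
      simp only [hw]
      rw [MulChar.one_apply (isUnit_one.neg)]; norm_num
    rw [hw1]
    ring
  -- prime sides
  have hsumP : ∑ χ : DirichletCharacter ℂ q, w χ * ∑ n ∈ weilPrimeIndex a, c n * (χ (n : ZMod q)).re =
      (q.totient : ℝ) * ((∑ n ∈ (weilPrimeIndex a).filter (fun n : ℕ ↦ (n : ZMod q) = 1), c n) +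
        ∑ n ∈ (weilPrimeIndex a).filter (fun n : ℕ ↦ (n : ZMod q) = -1), c n) := by
    simp_rw [Finset.mul_sum]
    rw [Finset.sum_comm]
    have hin : ∀ n ∈ weilPrimeIndex a,
        ∑ χ : DirichletCharacter ℂ q, w χ * (c n * (χ (n : ZMod q)).re) =
          (q.totient : ℝ) * (c n * ((if (n : ZMod q) = 1 then 1 else 0) +
            (if (n : ZMod q) = -1 then 1 else 0))) := by
      intro n _
      have : ∀ χ : DirichletCharacter ℂ q, w χ * (c n * (χ (n : ZMod q)).re) =
          c n * ((1 + (χ (((-1 : (ZMod q)ˣ)) : ZMod q)).re) * (χ (n : ZMod q)).re) := fun χ ↦ by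
        simp only [hw, Units.val_neg, Units.val_one]; ring
      simp_rw [this]
      rw [← Finset.mul_sum, sum_weight_mul_re_char]
      have hiff : ((-1 : (ZMod q)ˣ) : ZMod q) * (n : ZMod q) = 1 ↔ (n : ZMod q) = -1 := by
        rw [Units.val_neg, Units.val_one, neg_one_mul, neg_eq_iff_eq_neg]
      rw [Units.val_neg, Units.val_one] at hiff ⊢
      simp only [hiff]
      split_ifs <;> ring
    rw [Finset.sum_congr rfl hin, ← Finset.mul_sum]
    congr 1
    simp_rw [mul_add, Finset.sum_add_distrib, mul_ite, mul_one, mul_zero, Finset.sum_ite, Finset.sum_const_zero,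
      add_zero]
  -- constants: only even characters carry weight, each with `K₀ − I₀/a ≥ 5.3716 − 5/a`
  have hsumK : (q.totient : ℝ) * (5.3716 - 5 / a) ≤ ∑ χ : DirichletCharacter ℂ q, w χ * K χ := by
    rw [← hsumw, Finset.sum_mul]
    refine Finset.sum_le_sum fun χ _ ↦ ?_
    by_cases hev : χ.Even
    · refine mul_le_mul_of_nonneg_left ?_ (weight_nonneg χ _)
      have h1 := flatWindow_archConst_ge ha χ
      rw [if_pos hev] at h1
      simpa only [hK] using h1
    · have hw0 : w χ = 0 := by simp only [hw]; rw [weight_neg_one_eq, if_neg hev]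
      rw [hw0, zero_mul, zero_mul]
  have htot := Finset.sum_le_sum fun χ (_ : χ ∈ (Finset.univ : Finset (DirichletCharacter ℂ q))) ↦ hslot χ
  simp_rw [mul_add] at htot
  rw [Finset.sum_add_distrib] at htot
  have h2 : ∑ χ : DirichletCharacter ℂ q, w χ * (2 * ∑ n ∈ weilPrimeIndex a, c n * (χ (n : ZMod q)).re) =
      2 * ∑ χ : DirichletCharacter ℂ q, w χ * ∑ n ∈ weilPrimeIndex a, c n * (χ (n : ZMod q)).re := by
    rw [Finset.mul_sum]
    exact Finset.sum_congr rfl fun χ _ ↦ by ring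
  rw [h2, hsumP, hsumB] at htot
  have e32 : (32 : ℝ) * Real.sinh (a / 2) ^ 2 / a = 2 * (16 * Real.sinh (a / 2) ^ 2 / a) := by ring
  linarith

/-- **The totally real discriminant form** (`q ≥ 3`): the even rungs at one window `a > 0` force
`(φ(q)/2)(5.3716 − 5/a) − 16 sinh²(a/2)/a ≤ (φ(q)/2 − 1)·log q` — Odlyzko's GRH shape
`(1/n) log|d| ≥ log(8πe^{γ+π/2}) − O(1/a) − pole/n` for the maximal real subfield `ℚ(ζ_q)⁺`
(`n = φ(q)/2`, `log |d| ≤ (n − 1) log q`).  RH/GRH-free. -/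
theorem log_level_ge_of_evenCharacterFamily [NeZero q] (hq : 2 < q) (ha : 0 < a)
    (hζ : WeilPositivityOn a)
    (hχ : ∀ χ : DirichletCharacter ℂ q, χ ≠ 1 → χ.Even → WeilPositivityOnChar χ a) :
    (q.totient : ℝ) / 2 * (5.3716 - 5 / a) - 16 * Real.sinh (a / 2) ^ 2 / a ≤
      ((q.totient : ℝ) / 2 - 1) * Real.log q := by
  have h := evenCharacterFamily_flatWindow_floor_le hq ha hζ hχ
  have hS1 : 0 ≤ ∑ n ∈ (weilPrimeIndex a).filter (fun n : ℕ ↦ (n : ZMod q) = 1),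
      (Λ n : ℝ) / Real.sqrt n * (1 - Real.log n / (2 * a)) :=
    Finset.sum_nonneg fun n hn ↦ flatSum_term_nonneg ha (Finset.mem_of_mem_filter n hn)
  have hS2 : 0 ≤ ∑ n ∈ (weilPrimeIndex a).filter (fun n : ℕ ↦ (n : ZMod q) = -1),
      (Λ n : ℝ) / Real.sqrt n * (1 - Real.log n / (2 * a)) :=
    Finset.sum_nonneg fun n hn ↦ flatSum_term_nonneg ha (Finset.mem_of_mem_filter n hn)
  have hφ : (0 : ℝ) ≤ q.totient := Nat.cast_nonneg _
  nlinarith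

end Summit.Ventures.WeilGRH

end
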